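import Mathlib
import Summits.ValiantsHypothesis.ValiantsHypothesis.Theorems.LiouvilleSarnakLiouvilleCutRankMultiplicativeBarrier

/-!
# Route LiouvilleSarnak — crux `LiouvilleCutRank` (stmt-ValiantsHypothesis-14775): the MOD-8 BARRIER —
# a completely multiplicative twin of `λ` with `f(2) = f(3) = f(5) = -1` and bounded aligned cut rank

`…MultiplicativeBarrier.lean` (p825227) exhibited the `χ₄`-twin `f(2^v M) = (-1)^v χ₄(M)`: completely multiplicative,
`±1`-valued, `f(2) = f(3) = f(7) = -1`, aligned cut rank `≤ 4` at every level — and concluded that a proof of the crux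
(already of its aligned rung) "must use a prime `p ≡ 1 (mod 4)`".  That conclusion is too optimistic: this file
exhibits the `χ₈`-TWIN `f(2^v M) = (-1)^v χ₈(M)` (`χ₈(M) = -1` iff `M ≡ ±3 (mod 8)`), completely multiplicative and
`±1`-valued with `f(2) = f(3) = f(5) = -1` — so it agrees with `λ` at `2, 3, 5, 11, 13, 19, 29, …`, at EVERY prime
`p ≡ ±3 (mod 8)`, including `p = 5 ≡ 1 (mod 4)` — whose aligned cut matrices `(f(a + 2^n b + 1))_{a,b<2^n}` have rank
`≤ 6` for every `n ≥ 3` (★ `exists_completelyMultiplicative_chi8_alignedRank_le_six`).  Together with the `χ₄`-twin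
(agreement at `p ≡ 3 (mod 4)`) and the `χ₄χ₈`-twin (agreement at `p ≡ 5, 7 (mod 8)`; same proof, not repeated), the
three real characters of conductor dividing `8` give:

PLANNING CONSEQUENCE (honest framing).  Any proof of `LiouvilleCutRank` — or of its one-scale stub, or of the aligned
rung — from complete multiplicativity plus the values `λ(p) = -1` at a set `S` of odd primes must have `S` NOT contained
in `{p ≡ 3, 7 (8)}`, nor in `{p ≡ 3, 5 (8)}`, nor in `{p ≡ 5, 7 (8)}`: `S` must contain a prime `p ≡ 1 (mod 8)`
(`17, 41, 73, …`) or meet all three classes `3, 5, 7 (mod 8)`.  The smallest initial segment of primes that works is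
`{2, 3, 5, 7}`; `{2, 3, 5}` does not.  This matches the relaxed-model numerics of the session that landed
`…CycleCertificates.lean` (exact minimum number of distinct rows forced by "`f(p m) = -f(m)` for `p ≤ B`" on the
Thue–Morse cut word of length `12`, all `64` rows: `9` for `B = 3`, `10` for `B = 5`, `44` for `B = 7`).

On non-aligned cuts the `χ₈`-twin's rank grows (numerically `2n - 2` on `(CR)^n`, `≈ 1.3 n` on Thue–Morse cuts), so
the twin refutes the crux only through its aligned cuts; it says nothing about `λ`.  `LiouvilleCutRank`,
`DigitalBilinearLiouville`, `AlgebraicSarnak` stay OPEN; nothing bears on `VP ≠ VNP`.  No definitions (the witness is an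
explicit term).
-/

set_option linter.dupNamespace false

noncomputable section

namespace Summit.ValiantsHypothesis.ValiantsHypothesis.Theorems.LiouvilleSarnakLiouvilleCutRank.ModEightBarrier

open Finset

open Summit.ValiantsHypothesis.ValiantsHypothesis.Theorems.LiouvilleSarnakLiouvilleCutRank.OneBlock
  (rank_le_card_image_row)
open Summit.ValiantsHypothesis.ValiantsHypothesis.Theorems.LiouvilleSarnakLiouvilleCutRank.MultiplicativeBarrier
  (exists_eq_two_pow_mul_odd)

/-! ### §1 The witness `f(2^v M) = (-1)^v χ₈(M)` on numbers `2^v · odd` -/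

/-- The witness evaluated at `2^v · M`, `M` odd: `(-1)^v · χ₈(M)` with `χ₈(M) = -1` iff `M ≡ 3, 5 (mod 8)`.
[folklore] -/
theorem witness_two_pow_mul_odd (v M : ℕ) (hM : M % 2 = 1) :
    (fun m : ℕ => (-1 : ℤ) ^ (m.factorization 2) *
        (if (m / 2 ^ (m.factorization 2)) % 8 = 3 ∨ (m / 2 ^ (m.factorization 2)) % 8 = 5 then -1 else 1))
        (2 ^ v * M) =
      (-1 : ℤ) ^ v * (if M % 8 = 3 ∨ M % 8 = 5 then -1 else 1) := by
  have hM0 : M ≠ 0 := by intro h; simp [h] at hM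
  have hfac : (2 ^ v * M).factorization 2 = v := by
    rw [Nat.factorization_mul (pow_ne_zero _ two_ne_zero) hM0, Finsupp.add_apply,
      Nat.Prime.factorization_pow Nat.prime_two, Finsupp.single_eq_same,
      Nat.factorization_eq_zero_of_not_dvd (fun h => by omega), add_zero]
  simp only [hfac, Nat.mul_div_cancel_left M (Nat.two_pow_pos v)]

/-- For odd `M₁, M₂`: `χ₈(M₁ M₂) = χ₈(M₁) χ₈(M₂)` in the `±1` form (the residues `±3 (mod 8)` form the nontrivial
coset of the squares `±1` in `(ℤ/8)ˣ`). [folklore] -/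
theorem sign_mul_of_odd (M₁ M₂ : ℕ) (h₁ : M₁ % 2 = 1) (h₂ : M₂ % 2 = 1) :
    (if (M₁ * M₂) % 8 = 3 ∨ (M₁ * M₂) % 8 = 5 then (-1 : ℤ) else 1) =
      (if M₁ % 8 = 3 ∨ M₁ % 8 = 5 then (-1 : ℤ) else 1) *
        (if M₂ % 8 = 3 ∨ M₂ % 8 = 5 then (-1 : ℤ) else 1) := by
  have hm : (M₁ * M₂) % 8 = ((M₁ % 8) * (M₂ % 8)) % 8 := Nat.mul_mod _ _ _
  have h1' : M₁ % 8 = 1 ∨ M₁ % 8 = 3 ∨ M₁ % 8 = 5 ∨ M₁ % 8 = 7 := by omega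
  have h2' : M₂ % 8 = 1 ∨ M₂ % 8 = 3 ∨ M₂ % 8 = 5 ∨ M₂ % 8 = 7 := by omega
  rcases h1' with ha | ha | ha | ha <;> rcases h2' with hb | hb | hb | hb <;> simp [hm, ha, hb]

/-! ### §2 The barrier -/

/-- ★ **The mod-8 barrier.**  There is a completely multiplicative `f : ℕ → ℤ` with values in `{1, -1}` on the
positive integers, with `f(2) = f(3) = f(5) = -1`, `f(7) = 1`, and `f(m) = -1` for every `m ≡ ±3 (mod 8)` (so
`f(p) = λ(p)` for every prime `p ≡ 3, 5 (mod 8)`), such that for every `n ≥ 3` the aligned cut matrix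
`(f(a + 2^n b + 1))_{a,b<2^n}` has rank `≤ 6`.  Witness: `f(2^v M) = (-1)^v χ₈(M)` (`M` odd): the row `a` is the
constant `f(a+1)` unless `2^{n-2} ∣ a + 1`, so there are at most six distinct rows. [folklore] -/
theorem exists_completelyMultiplicative_chi8_alignedRank_le_six :
    ∃ f : ℕ → ℤ, (∀ m, 1 ≤ m → f m = 1 ∨ f m = -1) ∧ (∀ a b, 1 ≤ a → 1 ≤ b → f (a * b) = f a * f b) ∧
      f 2 = -1 ∧ f 3 = -1 ∧ f 5 = -1 ∧ f 7 = 1 ∧ (∀ m, m % 8 = 3 ∨ m % 8 = 5 → f m = -1) ∧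
      ∀ n, 3 ≤ n → (Matrix.of fun a b : Fin (2 ^ n) =>
        ((f ((a : ℕ) + 2 ^ n * (b : ℕ) + 1) : ℤ) : ℂ)).rank ≤ 6 := by
  classical
  let f : ℕ → ℤ := fun m =>
    (-1 : ℤ) ^ (m.factorization 2) *
      (if (m / 2 ^ (m.factorization 2)) % 8 = 3 ∨ (m / 2 ^ (m.factorization 2)) % 8 = 5 then -1 else 1)
  have hf : ∀ v M : ℕ, M % 2 = 1 →
      f (2 ^ v * M) = (-1 : ℤ) ^ v * (if M % 8 = 3 ∨ M % 8 = 5 then -1 else 1) :=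
    fun v M hM => witness_two_pow_mul_odd v M hM
  have hodd1 : ∀ m, m % 2 = 1 → f m = (if m % 8 = 3 ∨ m % 8 = 5 then -1 else 1) := by
    intro m hm
    have := hf 0 m hm
    simpa using this
  refine ⟨f, fun m hm => ?_, fun a b ha hb => ?_, ?_, ?_, ?_, ?_, fun m hm => ?_, fun n hn => ?_⟩
  · -- values `±1`
    obtain ⟨v, M, hM, rfl⟩ := exists_eq_two_pow_mul_odd m (by omega)
    rw [hf v M hM]
    rcases neg_one_pow_eq_or ℤ v with h | h <;> rw [h] <;> split_ifs <;> simp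
  · -- complete multiplicativity
    obtain ⟨v, M, hM, rfl⟩ := exists_eq_two_pow_mul_odd a (by omega)
    obtain ⟨v', M', hM', rfl⟩ := exists_eq_two_pow_mul_odd b (by omega)
    have hMM : (M * M') % 2 = 1 := by
      have := Nat.mul_mod M M' 2; rw [hM, hM'] at this; simpa using this
    rw [show 2 ^ v * M * (2 ^ v' * M') = 2 ^ (v + v') * (M * M') by ring, hf _ _ hMM, hf v M hM,
      hf v' M' hM', sign_mul_of_odd M M' hM hM', pow_add]
    ring
  · -- `f 2 = -1`
    have := hf 1 1 (by norm_num)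
    simpa using this
  · -- `f 3 = -1`
    rw [hodd1 3 (by norm_num)]; norm_num
  · -- `f 5 = -1`
    rw [hodd1 5 (by norm_num)]; norm_num
  · -- `f 7 = 1`
    rw [hodd1 7 (by norm_num)]; norm_num
  · -- `f m = -1` for `m ≡ ±3 (mod 8)`
    have h1 : m % 2 = 1 := by omega
    rw [hodd1 m h1, if_pos hm]
  · -- the aligned matrix has at most six distinct rows
    set A : Matrix (Fin (2 ^ n)) (Fin (2 ^ n)) ℂ := Matrix.of fun a b : Fin (2 ^ n) =>
        ((f ((a : ℕ) + 2 ^ n * (b : ℕ) + 1) : ℤ) : ℂ) with hA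
    -- generic rows are constant
    have hconst : ∀ a : Fin (2 ^ n), ((a : ℕ) + 1).factorization 2 + 3 ≤ n →
        A a = fun _ => ((f ((a : ℕ) + 1) : ℤ) : ℂ) := by
      intro a hv
      funext b
      simp only [hA, Matrix.of_apply]
      congr 1
      obtain ⟨v, M, hM, hm⟩ := exists_eq_two_pow_mul_odd ((a : ℕ) + 1) (Nat.succ_ne_zero _)
      have hvf : ((a : ℕ) + 1).factorization 2 = v := by
        rw [hm, Nat.factorization_mul (pow_ne_zero _ two_ne_zero) (by omega), Finsupp.add_apply,
          Nat.Prime.factorization_pow Nat.prime_two, Finsupp.single_eq_same,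
          Nat.factorization_eq_zero_of_not_dvd (fun h => by omega), add_zero]
      rw [hvf] at hv
      -- `a + 1 + 2^n b = 2^v (M + 8K)` with `K = 2^(n-v-3) b`: odd and `≡ M (mod 8)`
      have h2 : 2 ^ n = 2 ^ v * (2 ^ (n - v - 3) * 8) := by
        rw [show (8 : ℕ) = 2 ^ 3 by norm_num, ← pow_add, ← pow_add]; congr 1; omega
      have h3 : 2 ^ n * (b : ℕ) = 2 ^ v * (2 ^ (n - v - 3) * 8) * (b : ℕ) := by rw [← h2]
      set K : ℕ := 2 ^ (n - v - 3) * (b : ℕ) with hK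
      have hsplit : (a : ℕ) + 2 ^ n * (b : ℕ) + 1 = 2 ^ v * (M + 8 * K) := by
        calc (a : ℕ) + 2 ^ n * (b : ℕ) + 1 = ((a : ℕ) + 1) + 2 ^ n * (b : ℕ) := by ring
          _ = 2 ^ v * M + 2 ^ v * (2 ^ (n - v - 3) * 8) * (b : ℕ) := by rw [hm, h3]
          _ = 2 ^ v * (M + 8 * K) := by rw [hK]; ring
      have hodd : (M + 8 * K) % 2 = 1 := by omega
      have hmod : (M + 8 * K) % 8 = M % 8 := by omega
      rw [hsplit, hf _ _ hodd, hm, hf v M hM, hmod]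
    -- the exceptional rows: `2^(n-2) ∣ a + 1`, i.e. `a + 1 = k · 2^(n-2)` with `1 ≤ k ≤ 4`
    have hexc : ∀ a : Fin (2 ^ n), ¬ ((a : ℕ) + 1).factorization 2 + 3 ≤ n →
        (a : ℕ) + 1 = 2 ^ (n - 2) ∨ (a : ℕ) + 1 = 2 * 2 ^ (n - 2) ∨ (a : ℕ) + 1 = 3 * 2 ^ (n - 2) ∨
          (a : ℕ) + 1 = 4 * 2 ^ (n - 2) := by
      intro a hv
      have hdvd : 2 ^ (n - 2) ∣ (a : ℕ) + 1 := by
        have h1 : 2 ^ (((a : ℕ) + 1).factorization 2) ∣ (a : ℕ) + 1 := Nat.ordProj_dvd _ _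
        exact dvd_trans (pow_dvd_pow 2 (by omega)) h1
      obtain ⟨k, hk⟩ := hdvd
      have ha : (a : ℕ) < 2 ^ n := a.isLt
      have h2n : 2 ^ n = 4 * 2 ^ (n - 2) := by
        rw [show (4 : ℕ) = 2 ^ 2 by norm_num, ← pow_add]; congr 1; omega
      have hc : 1 ≤ 2 ^ (n - 2) := Nat.one_le_two_pow
      have hkpos : 1 ≤ k := by
        rcases Nat.eq_zero_or_pos k with h0 | h0
        · simp [h0] at hk
        · exact h0
      have hk4 : k ≤ 4 := by
        by_contra h5
        have h5' : 5 ≤ k := by omega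
        have : 2 ^ (n - 2) * 5 ≤ 2 ^ (n - 2) * k := Nat.mul_le_mul_left _ h5'
        omega
      interval_cases k
      · left; omega
      · right; left; omega
      · right; right; left; omega
      · right; right; right; omega
    have hlt : ∀ k : ℕ, 1 ≤ k → k ≤ 4 → k * 2 ^ (n - 2) - 1 < 2 ^ n := by
      intro k hk1 hk4
      have h2n : 2 ^ n = 4 * 2 ^ (n - 2) := by
        rw [show (4 : ℕ) = 2 ^ 2 by norm_num, ← pow_add]; congr 1; omega
      have : k * 2 ^ (n - 2) ≤ 4 * 2 ^ (n - 2) := Nat.mul_le_mul_right _ hk4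
      have : 1 ≤ 2 ^ (n - 2) := Nat.one_le_two_pow
      omega
    set a₁ : Fin (2 ^ n) := ⟨1 * 2 ^ (n - 2) - 1, hlt 1 le_rfl (by norm_num)⟩ with ha₁
    set a₂ : Fin (2 ^ n) := ⟨2 * 2 ^ (n - 2) - 1, hlt 2 (by norm_num) (by norm_num)⟩ with ha₂
    set a₃ : Fin (2 ^ n) := ⟨3 * 2 ^ (n - 2) - 1, hlt 3 (by norm_num) (by norm_num)⟩ with ha₃
    set a₄ : Fin (2 ^ n) := ⟨4 * 2 ^ (n - 2) - 1, hlt 4 (by norm_num) le_rfl⟩ with ha₄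
    have hpos : 1 ≤ 2 ^ (n - 2) := Nat.one_le_two_pow
    have himage : (Finset.univ.image fun a : Fin (2 ^ n) => A a) ⊆
        {(fun _ => (1 : ℂ)), (fun _ => (-1 : ℂ)), A a₁, A a₂, A a₃, A a₄} := by
      intro x hx
      rw [Finset.mem_image] at hx
      obtain ⟨a, -, rfl⟩ := hx
      simp only [Finset.mem_insert, Finset.mem_singleton]
      by_cases hv : ((a : ℕ) + 1).factorization 2 + 3 ≤ n
      · rw [hconst a hv]
        obtain ⟨v, M, hM, hm⟩ := exists_eq_two_pow_mul_odd ((a : ℕ) + 1) (Nat.succ_ne_zero _)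
        rw [hm, hf v M hM]
        rcases neg_one_pow_eq_or ℤ v with h | h <;> rw [h] <;> split_ifs <;> simp
      · rcases hexc a hv with h | h | h | h
        · right; right; left
          have : a = a₁ := by rw [ha₁]; ext; simp; omega
          rw [this]
        · right; right; right; left
          have : a = a₂ := by rw [ha₂]; ext; simp; omega
          rw [this]
        · right; right; right; right; left
          have : a = a₃ := by rw [ha₃]; ext; simp; omega
          rw [this]
        · right; right; right; right; right
          have : a = a₄ := by rw [ha₄]; ext; simp; omega
          rw [this]
    calc A.rank ≤ (Finset.univ.image fun a : Fin (2 ^ n) => A a).card := rank_le_card_image_row A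
      _ ≤ ({(fun _ => (1 : ℂ)), (fun _ => (-1 : ℂ)), A a₁, A a₂, A a₃, A a₄} :
            Finset (Fin (2 ^ n) → ℂ)).card := Finset.card_le_card himage
      _ ≤ 6 := by
          refine (Finset.card_insert_le _ _).trans ?_
          refine (Nat.succ_le_succ (Finset.card_insert_le _ _)).trans ?_
          refine (Nat.succ_le_succ (Nat.succ_le_succ (Finset.card_insert_le _ _))).trans ?_
          refine (Nat.succ_le_succ (Nat.succ_le_succ (Nat.succ_le_succ
            (Finset.card_insert_le _ _)))).trans ?_
          refine (Nat.succ_le_succ (Nat.succ_le_succ (Nat.succ_le_succ (Nat.succ_le_succ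
            (Finset.card_insert_le _ _))))).trans ?_
          simp

end Summit.ValiantsHypothesis.ValiantsHypothesis.Theorems.LiouvilleSarnakLiouvilleCutRank.ModEightBarrier
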